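import Summits.BirchSwinnertonDyer.BirchSwinnertonDyer.Theorems.EisensteinPrimesAcTwistDeformationAlmostDivisible
import HarnessLib

/-!
# Route `EisensteinPrimes` (rung K5), crux 2 `GoodLatticeBDPValue`, line `halves` v19.1, V21 index road
# input S2 (SUR_f at `v̄`) — the arena, part 1: the one-variable twist deformation `𝐃 = A ⊗ Λ^*(κ⁻¹)`
# (`bigRep`) of a `p`-primary `A` of Pontryagin CORANK `n` (e.g. `A = E[p^∞] ≃ (ℚ_p/ℤ_p)²`) is COFREE OF
# CORANK `n`, RFX, cofinitely generated and `Λ`-divisible, and LOC⁽²⁾ follows from LOC⁽¹⁾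
# (helper for stmt-BirchSwinnertonDyer-19032)

Cell `bsd-eis` (home `run/shared/lean/pub/bsd-eis/`), seat `bsd-line-x1-p1-w3` gen 3 (D-0154 width seat
on crux 2 `GoodLatticeBDPValue`, line `halves` v19.1). LEAD g4's V21 index road
(`Cruxes/GoodLatticeBDPValue/Lines/halves-imprimLambda-index-road.md`) needs on the CURVE side the
surjectivity SUR_f (§4 S2: `H¹(K_Σ/K_∞, E[p^∞]) ↠ ⊕_{j<s} H¹(K_{∞,w_j}, E[p^∞])`) and weak Leopoldt WL_f
(§4 S4), both of which Greenberg's theory (2016 Prop. 2.6.3; 2006 Props. 4.1/4.2) delivers for the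
one-variable twist deformation `𝐃 = T_pE ⊗ Λ^ι ⊗ Λ̂ = E[p^∞] ⊗ Λ^*(κ⁻¹)` — memo §3 bullet 2 "Greenberg 2016
Prop 2.6.3 for `T_pE ⊗ Λ^ι` (LEAD g2 template)". LEAD g2's road (A) (`…AcTwistDeformationCofree`) built
the arena for a corank-ONE `A` ("`ℤ_p ≅ Hom(A, C)` through one character `j`"); THIS FILE is its
corank-`n` twin, the hypothesis being a DUAL BASIS `j : Fin n → Hom(A, C)`
(`c ↦ Σ_k j_k ∘ (c_k • ·)` is a bijection `ℤ_pⁿ ≅ Hom(A, C)`; supplied in §3 from any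
`e : A ≃ₗ[ℤ_p] (Fin n → ℚ_p/ℤ_p)` for `C = ℚ/ℤ` and `C = K̄ˣ`):

* §1 the `n`-dimensional MOMENT PAIRING `Λⁿ → Hom(𝐃, C)`, `F ↦ (Φ ↦ Σ_k j_k((F_k • Φ)(0)))`, a bijection
  (terminating Mahler expansion `eq_sum_binom`), whence EVERY balanced `C`-dual of `𝐃 = BigRepModule ℤ_[p] p A`
  is `≃ₗ Λⁿ` (`nonempty_linearEquiv_pi_of_isDualPairing`);
* §2 the clauses of Greenberg's arena: `isCofree_bigRepModule_pi`, `hasCorank_bigRepModule_pi` (`= n`),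
  `isCofinitelyGenerated_bigRepModule_pi`, `rfx_bigRepModule_pi`, `isDivisible_bigRepModule_pi`
  (`Λⁿ` is torsion-free over the domain `Λ = ℤ_p⟦T⟧`);
* §3 the dual bases from `e : A ≃ₗ[ℤ_p] (Fin n → ℚ_p/ℤ_p)`: `exists_pi_character_hinj_hsurj_of_linearEquiv`
  (`C = ℚ/ℤ`) and `exists_pi_unitsCarrier_hinj_hsurj_of_linearEquiv` (`C = K̄ˣ`, `char K = 0`), from the
  tree's corank-one `QpModZp.character_hinj_hsurj_of_linearEquiv` / `exists_unitsCarrier_hinj_hsurj_of_linearEquiv`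
  coordinate by coordinate;
* §4 `bigRep_LOC2_pi` — LOC_v⁽²⁾(`𝐃`) at every place with LOC_v⁽¹⁾(`𝐃`): every Tate dual `T* ≅ Hom(𝐃, K̄ˣ)` is
  free of rank `n`, so `T*/(T*)^{G_{K_v}} = T*` is reflexive (`Greenberg2016.loc2_of_loc1_of_free`).

Elementary and unconditional; THEOREMS ONLY (the pairing is produced as `∃ μ`, no `def`); no named fact,
no `sorry`. HONEST FRAMING: generic algebra of the arena; closes nothing by itself (`--supports`); no
summit statement / BSD / IMC2 / KY Thm. 1.4.1 (iii) is proved by this file. References: [Greenberg2006]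
p. 342 L5–11 ("`𝒟 = 𝒯 ⊗_Λ Λ̂`, which is a cofree `Λ`-module"); [Greenberg2016Selmer] §1 p. 4 L5–13, §2.1
p. 6 L1–10, §2.5 p. 8, §4.3 p. 20 L10–30 (twist deformations of a free `ℤ_p`-module `T` of rank `n`);
[Greenberg2010] Prop. 3.2.1; [SkinnerUrban2014] Prop. 3.2.3.
-/

set_option autoImplicit false
set_option linter.dupNamespace false

noncomputable section

open scoped Classical
open Finset PowerSeries IsLocalRing NumberField IsDedekindDomain
open Literature.NumberTheory.EllipticCurves Literature.NumberTheory.IwasawaTheory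
  Literature.NumberTheory.IwasawaTheory.Greenberg2016 Literature.NumberTheory.IwasawaTheory.Greenberg2006
  Literature.NumberTheory.GaloisRepresentations
  Summit.BirchSwinnertonDyer.BirchSwinnertonDyer.Theorems.TwistDeformationCofree

namespace Summit.BirchSwinnertonDyer.BirchSwinnertonDyer.Theorems.AcTwistDeformation

/-! ## §1 The `n`-dimensional moment pairing `Λⁿ ≅ Hom(𝐃, C)` and the structure of every balanced dual -/

section DualityRank

variable {p : ℕ} [Fact p.Prime] {A : Type} [AddCommGroup A] [Module ℤ_[p] A]
  {C : Type*} [AddCommGroup C] {n : ℕ} (jC : Fin n → (A →+ C))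

/-- **The `n`-dimensional MOMENT PAIRING exists**: an additive `μ : Λⁿ → Hom(𝐃, C)` with
`μ F Φ = Σ_k j_k((F_k • Φ)(0))` (Iwasawa–Serre + Pontryagin on each coordinate of a dual basis
`j : Fin n → Hom(A, C)`; produced as `∃ μ`, no `def`). [cite: Greenberg2006, p. 342 L5–11] -/
theorem exists_momentPairing_pi :
    ∃ μ : (Fin n → PowerSeries ℤ_[p]) →+ (BigRepModule ℤ_[p] p A →+ C),
      ∀ (F : Fin n → PowerSeries ℤ_[p]) (Φ : BigRepModule ℤ_[p] p A),
        μ F Φ = ∑ k, jC k ((F k • Φ) 0) := by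
  refine ⟨AddMonoidHom.mk' (fun F ↦ AddMonoidHom.mk' (fun Φ ↦ ∑ k, jC k ((F k • Φ) 0)) fun Φ Ψ ↦ ?_)
    fun F G ↦ ?_, fun F Φ ↦ rfl⟩
  · rw [← sum_add_distrib]
    exact sum_congr rfl fun k _ ↦ by rw [smul_add, BigRepModule.add_apply, map_add]
  · ext Φ
    simp only [AddMonoidHom.mk'_apply, AddMonoidHom.add_apply, Pi.add_apply, ← sum_add_distrib]
    exact sum_congr rfl fun k _ ↦ by rw [add_smul, BigRepModule.add_apply, map_add]

/-- **The moment pairing is injective** as soon as `ℤ_pⁿ → Hom(A, C)`, `c ↦ Σ_k j_k ∘ (c_k • ·)` is: its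
value on the `i`-th Mahler element `binom i a` is `Σ_k j_k(coeff_i(F_k) • a)`. [cite: Greenberg2006, p. 342 L5–11] -/
theorem momentPairing_pi_injective (hA : ∀ a : A, ∃ k : ℕ, p ^ k • a = 0)
    (hinj : ∀ c : Fin n → ℤ_[p], (∀ a : A, ∑ k, jC k (c k • a) = 0) → c = 0)
    {μ : (Fin n → PowerSeries ℤ_[p]) →+ (BigRepModule ℤ_[p] p A →+ C)}
    (hμ : ∀ (F : Fin n → PowerSeries ℤ_[p]) (Φ : BigRepModule ℤ_[p] p A),
      μ F Φ = ∑ k, jC k ((F k • Φ) 0)) :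
    Function.Injective μ := by
  refine (injective_iff_map_eq_zero _).mpr fun F hF ↦ ?_
  refine funext fun k ↦ PowerSeries.ext fun i ↦ ?_
  rw [Pi.zero_apply, map_zero]
  have h := hinj (fun k ↦ coeff i (F k)) fun a ↦ by
    have h1 := hμ F (binom (R := ℤ_[p]) hA i a)
    rw [hF, AddMonoidHom.zero_apply] at h1
    rw [h1]
    exact sum_congr rfl fun k _ ↦ by rw [smul_binom_apply_zero hA]
  exact congrFun h k

/-- **The moment pairing is surjective** as soon as every additive `A → C` is `Σ_k j_k ∘ (c_k • ·)`: the
preimage of `g ∈ Hom(𝐃, C)` is the family of series whose `i`-th coefficients represent `g ∘ binom i`,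
by the finite Mahler expansion. [cite: Greenberg2006, p. 342 L5–11] -/
theorem momentPairing_pi_surjective (hA : ∀ a : A, ∃ k : ℕ, p ^ k • a = 0)
    (hsurj : ∀ φ : A →+ C, ∃ c : Fin n → ℤ_[p], ∀ a : A, φ a = ∑ k, jC k (c k • a))
    {μ : (Fin n → PowerSeries ℤ_[p]) →+ (BigRepModule ℤ_[p] p A →+ C)}
    (hμ : ∀ (F : Fin n → PowerSeries ℤ_[p]) (Φ : BigRepModule ℤ_[p] p A),
      μ F Φ = ∑ k, jC k ((F k • Φ) 0)) :
    Function.Surjective μ := by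
  intro g
  choose c hc using fun i : ℕ ↦ hsurj (g.comp (binom (R := ℤ_[p]) hA i))
  refine ⟨fun k ↦ PowerSeries.mk fun i ↦ c i k, ?_⟩
  ext Φ
  obtain ⟨N, hN⟩ := BigRepModule.shiftSubOne_locNil Φ
  rw [eq_sum_binom (R := ℤ_[p]) hA hN, map_sum, map_sum]
  refine sum_congr rfl fun i _ ↦ ?_
  rw [hμ]
  simp_rw [smul_binom_apply_zero, coeff_mk]
  exact (hc i _).symm

/-- **Structure of the balanced duals of `𝐃` (Iwasawa–Serre + Pontryagin, corank `n`)**: if `A` is a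
`p`-primary `ℤ_p`-module with a dual basis `j : Fin n → Hom(A, C)` (`c ↦ Σ_k j_k ∘ (c_k • ·)` injective and
onto `Hom(A, C)`), then EVERY `Λ`-balanced `C`-dual `X ≅ Hom(𝐃, C)` of `𝐃 = A ⊗ Λ^*`
(`Greenberg2016.IsDualPairing Λ 𝐃 toDual`) is isomorphic to `Λⁿ` as a `Λ`-module: the free module on
the preimages `x_k` of the coordinate moment functionals `j_k ∘ eval₀`. With `C = ℚ/ℤ` this is "`𝒟` is a
cofree `Λ`-module" of rank `n`, with `C = K̄ˣ` it is "`T* ≅ Λⁿ`". [cite: Greenberg2006, p. 342 L5–11]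
[cite: Greenberg2016Selmer, §4.3 p. 20 L19–23] -/
theorem nonempty_linearEquiv_pi_of_isDualPairing (hA : ∀ a : A, ∃ k : ℕ, p ^ k • a = 0)
    (hinj : ∀ c : Fin n → ℤ_[p], (∀ a : A, ∑ k, jC k (c k • a) = 0) → c = 0)
    (hsurj : ∀ φ : A →+ C, ∃ c : Fin n → ℤ_[p], ∀ a : A, φ a = ∑ k, jC k (c k • a))
    {X : Type} [AddCommGroup X] [Module (PowerSeries ℤ_[p]) X]
    {toDual : X →+ (BigRepModule ℤ_[p] p A →+ C)}
    (hX : IsDualPairing (PowerSeries ℤ_[p]) (BigRepModule ℤ_[p] p A) toDual) :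
    Nonempty (X ≃ₗ[PowerSeries ℤ_[p]] (Fin n → PowerSeries ℤ_[p])) := by
  obtain ⟨μ, hμ⟩ := exists_momentPairing_pi (p := p) (A := A) jC
  -- the preimages of the coordinate functionals `μ(e_k)`
  choose x hx using fun k : Fin n ↦ hX.bijective.2 (μ (Pi.single k 1))
  let ψ : (Fin n → PowerSeries ℤ_[p]) →ₗ[PowerSeries ℤ_[p]] X :=
    Fintype.linearCombination (PowerSeries ℤ_[p]) x
  have hψ : ∀ F, toDual (ψ F) = μ F := by
    intro F
    ext Φ
    rw [Fintype.linearCombination_apply, map_sum, AddMonoidHom.finsetSum_apply, hμ]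
    refine sum_congr rfl fun k _ ↦ ?_
    rw [hX.map_smul, hx, hμ, Fintype.sum_eq_single k fun l hl ↦ by
      rw [Pi.single_eq_of_ne hl, zero_smul, BigRepModule.zero_apply, map_zero], Pi.single_eq_same, one_smul]
  have hbij : Function.Bijective ψ := by
    constructor
    · intro F G h
      apply momentPairing_pi_injective jC hA hinj hμ
      rw [← hψ, ← hψ, h]
    · intro y
      obtain ⟨F, hF⟩ := momentPairing_pi_surjective jC hA hsurj hμ (toDual y)
      exact ⟨F, hX.injective (by rw [hψ, hF])⟩
  exact ⟨(LinearEquiv.ofBijective ψ hbij).symm⟩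

/-! ## §2 The clauses of Greenberg's arena for `𝐃` of corank `n` -/

/-- **`𝐃 = A ⊗ Λ^*` IS A COFREE `Λ`-MODULE** (every Pontryagin dual is finite free), for `A` `p`-primary
of Pontryagin corank `n` (dual basis `j : Fin n → Hom(A, ℚ/ℤ)`, e.g. `A ≅ (ℚ_p/ℤ_p)ⁿ`): the clause
`IsCofree R 𝐃` (`R = Λ = ℤ_p⟦T⟧`) of `Greenberg2016.prop263_sur_of_crk` / `prop411_…`.
[cite: Greenberg2006, p. 342 L5–11] [cite: Greenberg2016Selmer, §4.3 p. 20 L19–23] -/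
theorem isCofree_bigRepModule_pi (hA : ∀ a : A, ∃ k : ℕ, p ^ k • a = 0)
    (jQ : Fin n → (A →+ AddCircle (1 : ℚ)))
    (hinj : ∀ c : Fin n → ℤ_[p], (∀ a : A, ∑ k, jQ k (c k • a) = 0) → c = 0)
    (hsurj : ∀ φ : A →+ AddCircle (1 : ℚ), ∃ c : Fin n → ℤ_[p], ∀ a : A, φ a = ∑ k, jQ k (c k • a)) :
    IsCofree (PowerSeries ℤ_[p]) (BigRepModule ℤ_[p] p A) := by
  intro X _ _ toDual hX
  obtain ⟨e⟩ := nonempty_linearEquiv_pi_of_isDualPairing jQ hA hinj hsurj hX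
  exact ⟨Module.Free.of_equiv e.symm, Module.Finite.equiv e.symm⟩

/-- **`corank_Λ 𝐃 = n`** — the `m = n` input of Greenberg 2006 Props. 4.1 / 4.2 for the one-variable twist
deformation of a corank-`n` `A`. [cite: Greenberg2006, p. 342 L5–11] -/
theorem hasCorank_bigRepModule_pi (hA : ∀ a : A, ∃ k : ℕ, p ^ k • a = 0)
    (jQ : Fin n → (A →+ AddCircle (1 : ℚ)))
    (hinj : ∀ c : Fin n → ℤ_[p], (∀ a : A, ∑ k, jQ k (c k • a) = 0) → c = 0)
    (hsurj : ∀ φ : A →+ AddCircle (1 : ℚ), ∃ c : Fin n → ℤ_[p], ∀ a : A, φ a = ∑ k, jQ k (c k • a)) :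
    HasCorank (PowerSeries ℤ_[p]) (BigRepModule ℤ_[p] p A) n := by
  intro X _ _ toDual hX
  obtain ⟨e⟩ := nonempty_linearEquiv_pi_of_isDualPairing jQ hA hinj hsurj hX
  rw [e.finrank_eq, Module.finrank_pi, Fintype.card_fin]

/-- `𝐃` is cofinitely generated over `Λ` (the standing clause of Props. 4.1, 4.2, §5 A, 3.2).
[cite: Greenberg2006, §4 p. 367 L33–39] -/
theorem isCofinitelyGenerated_bigRepModule_pi (hA : ∀ a : A, ∃ k : ℕ, p ^ k • a = 0)
    (jQ : Fin n → (A →+ AddCircle (1 : ℚ)))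
    (hinj : ∀ c : Fin n → ℤ_[p], (∀ a : A, ∑ k, jQ k (c k • a) = 0) → c = 0)
    (hsurj : ∀ φ : A →+ AddCircle (1 : ℚ), ∃ c : Fin n → ℤ_[p], ∀ a : A, φ a = ∑ k, jQ k (c k • a)) :
    IsCofinitelyGenerated (PowerSeries ℤ_[p]) (BigRepModule ℤ_[p] p A) :=
  IsCofree.isCofinitelyGenerated (isCofree_bigRepModule_pi hA jQ hinj hsurj)

/-- **RFX(`𝐃`)** ("Obviously, RFX(`𝒟`) is satisfied"). [cite: Greenberg2016Selmer, §4.3 p. 20 L23] -/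
theorem rfx_bigRepModule_pi (hA : ∀ a : A, ∃ k : ℕ, p ^ k • a = 0)
    (jQ : Fin n → (A →+ AddCircle (1 : ℚ)))
    (hinj : ∀ c : Fin n → ℤ_[p], (∀ a : A, ∑ k, jQ k (c k • a) = 0) → c = 0)
    (hsurj : ∀ φ : A →+ AddCircle (1 : ℚ), ∃ c : Fin n → ℤ_[p], ∀ a : A, φ a = ∑ k, jQ k (c k • a)) :
    RFX (PowerSeries ℤ_[p]) (BigRepModule ℤ_[p] p A) :=
  IsCofree.rfx (isCofree_bigRepModule_pi hA jQ hinj hsurj)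

/-- **`𝐃 = A ⊗ Λ^*` IS `Λ`-DIVISIBLE** (`θ𝐃 = 𝐃` for every non-zero `θ ∈ Λ = ℤ_p⟦T⟧`) — the clause "`𝐃`
is divisible as a `Λ`-module" of Prop. 2.6.3 / [Greenberg2010] Prop. 3.2.1: a character of `𝐃/θ𝐃` is a
`θ`-torsion element of the Pontryagin dual `Hom(𝐃, ℚ/ℤ) ≃ₗ Λⁿ`, torsion-free over the domain `Λ`, hence
`0`; `ℚ/ℤ` cogenerates. [cite: Greenberg2010, §1 p. 3 L1–5] [cite: Greenberg2016Selmer, §2.5 p. 8 L35–37] -/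
theorem isDivisible_bigRepModule_pi (hA : ∀ a : A, ∃ k : ℕ, p ^ k • a = 0)
    (jQ : Fin n → (A →+ AddCircle (1 : ℚ)))
    (hinj : ∀ c : Fin n → ℤ_[p], (∀ a : A, ∑ k, jQ k (c k • a) = 0) → c = 0)
    (hsurj : ∀ φ : A →+ AddCircle (1 : ℚ), ∃ c : Fin n → ℤ_[p], ∀ a : A, φ a = ∑ k, jQ k (c k • a)) :
    IsDivisible (PowerSeries ℤ_[p]) (BigRepModule ℤ_[p] p A) := by
  intro θ hθ Φ
  obtain ⟨e⟩ := nonempty_linearEquiv_pi_of_isDualPairing jQ hA hinj hsurj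
    (isDualPairing_characterModule (PowerSeries ℤ_[p]) (BigRepModule ℤ_[p] p A))
  by_contra hΦ
  let N : Submodule (PowerSeries ℤ_[p]) (BigRepModule ℤ_[p] p A) :=
    LinearMap.range (θ • (LinearMap.id : BigRepModule ℤ_[p] p A →ₗ[PowerSeries ℤ_[p]] BigRepModule ℤ_[p] p A))
  have hΦN : Submodule.Quotient.mk (p := N) Φ ≠ 0 := by
    intro h
    rw [Submodule.Quotient.mk_eq_zero, LinearMap.mem_range] at h
    obtain ⟨Ψ, hΨ⟩ := h
    exact hΦ ⟨Ψ, hΨ⟩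
  obtain ⟨χ, hχ⟩ := CharacterModule.exists_character_apply_ne_zero_of_ne_zero hΦN
  let c : CharacterModule (BigRepModule ℤ_[p] p A) := χ.comp N.mkQ.toAddMonoidHom
  have hc : c ≠ 0 := fun h ↦ hχ (DFunLike.congr_fun h Φ)
  have hθc : θ • c = 0 := by
    ext Ψ
    change χ (N.mkQ (θ • Ψ)) = 0
    have hmem : θ • Ψ ∈ N := ⟨Ψ, rfl⟩
    rw [Submodule.mkQ_apply, (Submodule.Quotient.mk_eq_zero N).mpr hmem, map_zero]
  have : θ • e c = 0 := by rw [← map_smul, hθc, map_zero]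
  rcases smul_eq_zero.mp this with h | h
  · exact hθ h
  · exact hc (e.injective (by rw [h, map_zero]))

end DualityRank

/-! ## §3 Dual bases from `e : A ≃ₗ[ℤ_p] (Fin n → ℚ_p/ℤ_p)` -/

section Supply

variable {p : ℕ} [hp : Fact p.Prime] {A : Type} [AddCommGroup A] [Module ℤ_[p] A] {n : ℕ}

/-- **A dual basis `Hom(A, C) ≅ ℤ_pⁿ` from ONE injective `j₀ : ℚ_p/ℤ_p → C` with `ℤ_p ≅ Hom(ℚ_p/ℤ_p, C)`
through `j₀`**, for `A ≃ₗ[ℤ_p] (ℚ_p/ℤ_p)ⁿ`: `j_k = j₀ ∘ pr_k ∘ e`; `A` is `p`-primary; `Σ_k j_k(c_k • a) = 0`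
for all `a` forces `c = 0` (test on `e⁻¹(δ_k x)`), and every `φ : A → C` is `Σ_k j_k(c_k • ·)` with `c_k`
representing `φ ∘ e⁻¹ ∘ δ_k`. [cite: Hida2000, §3.2 (Pontryagin duality for ℚ_p/ℤ_p)] -/
theorem pi_hinj_hsurj_of_linearEquiv {C : Type*} [AddCommGroup C] (e : A ≃ₗ[ℤ_[p]] (Fin n → QpModZp p))
    (j₀ : QpModZp p →+ C)
    (hinj₀ : ∀ c : ℤ_[p], (∀ x : QpModZp p, j₀ (c • x) = 0) → c = 0)
    (hsurj₀ : ∀ φ : QpModZp p →+ C, ∃ c : ℤ_[p], ∀ x : QpModZp p, φ x = j₀ (c • x)) :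
    (∀ a : A, ∃ k : ℕ, p ^ k • a = 0) ∧
      (∀ c : Fin n → ℤ_[p],
        (∀ a : A, ∑ k, (j₀.comp ((LinearMap.proj k).comp e.toLinearMap).toAddMonoidHom) (c k • a) = 0) →
          c = 0) ∧
      ∀ φ : A →+ C, ∃ c : Fin n → ℤ_[p], ∀ a : A,
        φ a = ∑ k, (j₀.comp ((LinearMap.proj k).comp e.toLinearMap).toAddMonoidHom) (c k • a) := by
  have hj : ∀ (k : Fin n) (c : ℤ_[p]) (a : A),
      (j₀.comp ((LinearMap.proj k).comp e.toLinearMap).toAddMonoidHom) (c • a) = j₀ (c • e a k) := by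
    intro k c a
    simp only [AddMonoidHom.coe_comp, LinearMap.toAddMonoidHom_coe, Function.comp_apply,
      LinearMap.coe_comp, LinearEquiv.coe_coe, LinearMap.coe_proj, Function.eval, map_smul, Pi.smul_apply]
  refine ⟨fun a ↦ ?_, fun c hc ↦ funext fun k ↦ hinj₀ (c k) fun x ↦ ?_, fun φ ↦ ?_⟩
  · -- `A` is `p`-primary: coordinatewise
    choose m hm using fun k : Fin n ↦ QpModZp.exists_pow_nsmul_eq_zero (p := p) (e a k)
    refine ⟨∑ k, m k, e.injective ?_⟩
    rw [map_zero, ← Nat.cast_smul_eq_nsmul ℤ_[p], map_smul]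
    funext k
    rw [Pi.smul_apply, Pi.zero_apply, Nat.cast_smul_eq_nsmul,
      ← Nat.sub_add_cancel (single_le_sum (f := m) (fun l _ ↦ Nat.zero_le _) (mem_univ k)), pow_add,
      mul_smul, hm]
    exact smul_zero _
  · -- injectivity: test on `e⁻¹(δ_k x)`
    have h := hc (e.symm (Pi.single k x))
    simp_rw [hj, LinearEquiv.apply_symm_apply] at h
    rwa [Fintype.sum_eq_single k fun l hl ↦ by rw [Pi.single_eq_of_ne hl, smul_zero, map_zero],
      Pi.single_eq_same] at h
  · -- surjectivity: `φ = Σ_k (φ ∘ e⁻¹ ∘ δ_k) ∘ pr_k ∘ e`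
    choose c hc using fun k : Fin n ↦
      hsurj₀ (φ.comp (e.symm.toLinearMap.toAddMonoidHom.comp (LinearMap.single ℤ_[p] (fun _ ↦ QpModZp p) k).toAddMonoidHom))
    refine ⟨c, fun a ↦ ?_⟩
    simp_rw [hj, ← hc]
    simp only [AddMonoidHom.coe_comp, LinearMap.toAddMonoidHom_coe, Function.comp_apply, LinearMap.coe_single,
      LinearEquiv.coe_coe]
    rw [← map_sum, ← map_sum]
    congr 1
    rw [← e.symm_apply_apply a, LinearEquiv.apply_symm_apply]
    congr 1
    exact (Finset.univ_sum_single (e a)).symm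

/-- **The Pontryagin dual basis of `A ≃ₗ[ℤ_p] (ℚ_p/ℤ_p)ⁿ` over `ℚ/ℤ`**: `A` is `p`-primary and there is
`j : Fin n → Hom(A, ℚ/ℤ)` through which `ℤ_pⁿ ≅ Hom(A, ℚ/ℤ)` (from the tree's corank-one
`QpModZp.exists_character_hinj_hsurj_of_linearEquiv`). [cite: Hida2000, §3.2 (proof preceding Cor. 3.19)] -/
theorem exists_pi_character_hinj_hsurj_of_linearEquiv (e : A ≃ₗ[ℤ_[p]] (Fin n → QpModZp p)) :
    (∀ a : A, ∃ k : ℕ, p ^ k • a = 0) ∧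
      ∃ jQ : Fin n → (A →+ AddCircle (1 : ℚ)),
        (∀ c : Fin n → ℤ_[p], (∀ a : A, ∑ k, jQ k (c k • a) = 0) → c = 0) ∧
        ∀ φ : A →+ AddCircle (1 : ℚ), ∃ c : Fin n → ℤ_[p], ∀ a : A, φ a = ∑ k, jQ k (c k • a) := by
  obtain ⟨-, j₀, -, hinj₀, hsurj₀⟩ :=
    QpModZp.exists_character_hinj_hsurj_of_linearEquiv (LinearEquiv.refl ℤ_[p] (QpModZp p))
  obtain ⟨hA, hinj, hsurj⟩ := pi_hinj_hsurj_of_linearEquiv e j₀ hinj₀ hsurj₀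
  exact ⟨hA, _, hinj, hsurj⟩

/-- **The Tate dual basis of `A ≃ₗ[ℤ_p] (ℚ_p/ℤ_p)ⁿ` over `K̄ˣ`** (`char K = 0`): there is
`j : Fin n → Hom(A, K̄ˣ)` through which `ℤ_pⁿ ≅ Hom(A, K̄ˣ) = Hom(A, μ_{p^∞})` (from the tree's corank-one
`QpModZp.exists_unitsCarrier_hinj_hsurj_of_linearEquiv`). [cite: Greenberg2016Selmer, §2 p. 5 L15–35 (T* = Hom(𝐃, μ_{p^∞}))] -/
theorem exists_pi_unitsCarrier_hinj_hsurj_of_linearEquiv (K : Type) [Field K] [CharZero K]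
    (e : A ≃ₗ[ℤ_[p]] (Fin n → QpModZp p)) :
    ∃ jU : Fin n → (A →+ DiscreteGaloisModule.UnitsCarrier K),
      (∀ c : Fin n → ℤ_[p], (∀ a : A, ∑ k, jU k (c k • a) = 0) → c = 0) ∧
      ∀ φ : A →+ DiscreteGaloisModule.UnitsCarrier K, ∃ c : Fin n → ℤ_[p], ∀ a : A,
        φ a = ∑ k, jU k (c k • a) := by
  obtain ⟨j₀, -, hinj₀, hsurj₀⟩ :=
    QpModZp.exists_unitsCarrier_hinj_hsurj_of_linearEquiv K (LinearEquiv.refl ℤ_[p] (QpModZp p))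
  obtain ⟨-, hinj, hsurj⟩ := pi_hinj_hsurj_of_linearEquiv e j₀ hinj₀ hsurj₀
  exact ⟨_, hinj, hsurj⟩

end Supply

/-! ## §4 LOC⁽²⁾ from LOC⁽¹⁾ for `𝐃` of corank `n` -/

section LOC2Rank

variable {K : Type} [Field K] [NumberField K] (S : Set (HeightOneSpectrum (𝓞 K))) {p : ℕ} [Fact p.Prime]
  {A : Type} [AddCommGroup A] [Module ℤ_[p] A] [TopologicalSpace A] [DiscreteTopology A]
  [TopologicalSpace (PowerSeries ℤ_[p])]
  (hS : ∀ v : HeightOneSpectrum (𝓞 K), ((p : ℕ) : 𝓞 K) ∈ v.asIdeal → v ∈ S)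
  (κ : ZpExtension K p) (ρ₀ : ContinuousRep (GaloisGroupUnramifiedOutside K S) ℤ_[p] A) {n : ℕ}

/-- **LOC_v⁽²⁾(`𝐃`) at a place with LOC_v⁽¹⁾(`𝐃`)**, corank `n`: every Tate dual `T* ≅ Hom(𝐃, K̄ˣ)` of the
one-variable twist deformation of a corank-`n` `A` is free of rank `n` over `Λ = ℤ_p⟦T⟧`, hence
`T*/(T*)^{G_{K_v}} = T*` (LOC⁽¹⁾) is reflexive ("it is shown in part F of section 5 in [Gr4] that
LOC_v⁽²⁾(`𝒟`) is satisfied for all `v` in `Σ`"). [cite: Greenberg2016Selmer, §2.1 p. 6 L1–10, §4.3 p. 20 L23–26]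
[cite: Greenberg2006, p. 342 L5–11] -/
theorem bigRep_LOC2_pi (hA : ∀ a : A, ∃ k : ℕ, p ^ k • a = 0)
    (jU : Fin n → (A →+ DiscreteGaloisModule.UnitsCarrier K))
    (hinj : ∀ c : Fin n → ℤ_[p], (∀ a : A, ∑ k, jU k (c k • a) = 0) → c = 0)
    (hsurj : ∀ φ : A →+ DiscreteGaloisModule.UnitsCarrier K, ∃ c : Fin n → ℤ_[p], ∀ a : A,
      φ a = ∑ k, jU k (c k • a))
    (v : Place K) (h1 : LOC1 S (bigRep (κ.liftUnramifiedOutside S hS) ρ₀) v) :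
    LOC2 S (bigRep (κ.liftUnramifiedOutside S hS) ρ₀) v := by
  refine loc2_of_loc1_of_free h1 fun Y _ _ toDual hY ↦ ?_
  obtain ⟨e⟩ := nonempty_linearEquiv_pi_of_isDualPairing jU hA hinj hsurj hY
  exact ⟨Module.Free.of_equiv e.symm, Module.Finite.equiv e.symm⟩

end LOC2Rank

end Summit.BirchSwinnertonDyer.BirchSwinnertonDyer.Theorems.AcTwistDeformation

end
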